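import Summits.Ventures.QEC.Census.LPBounds.QuantumHammingBoundAllN
import Literature.InformationTheory.QuantumCodes.GottesmanCodes
import Literature.InformationTheory.QuantumCodes.GottesmanDistanceFourCodes
import Literature.InformationTheory.QuantumCodes.PerfectCodesFromPasting
import Literature.InformationTheory.QuantumCodes.AdditiveCodeOptimalRadius
import Literature.InformationTheory.Coding.VasilevCodesExist
import HarnessLib

/-!
# Exact distances of Gottesman's `⟦2^m, 2^m−m−2, 3⟧` and `⟦2^m, 2^m−2m−2, 4⟧` families via the all-`n` quantum Hamming
# bound, and their Q4 radius rows (optimal radius `1`); the five-qubit code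

LADDER-QEC (venture cell `qec`), PARTITION row 08 (Q4 theorem column for FAMILIES), an application of item 117
(`Census/LPBounds/QuantumHammingBoundAllN.lean`). The tree proves the families as `[[n,k,d]]` codes in CRSS's monotone
sense (`IsAdditiveCode … 3` / `… 4` = distance AT LEAST `3` / `4`: `CRSS1998_theorem10`, `Gottesman1997_distance_four`,
qec-lit-1); the radius column needs the EXACT distance. Here the matching upper bounds come for free from the quantum
Hamming bound AT EVERY LENGTH:

* `minDistance_eq_of_not_additiveCodeExists` — general pin: an `[[n,k,d]]` space `S̄` with `k ≥ 1` for which NO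
  `[[n,k,d+1]]` additive code exists has `minDistance S̄ = d`.
* `not_additiveCodeExists_two_pow_four (hm : 3 ≤ m) : ¬ [[2^m, 2^m−m−2, 4]]` — shorten to `[[2^m−1, 2^m−m−2, 3]]`
  (CRSS Thm 6 (d)) and apply `quantumHammingBound_three_allN`: `(3·2^m − 2)·2^k ≤ 2^{2^m−1}` would force `2^m ≤ 2`.
* `not_additiveCodeExists_two_pow_five (hm : 4 ≤ m) : ¬ [[2^m, 2^m−2m−2, 5]]` — `quantumHammingBound_five_allN` directly:
  `1 + 3N + 9·C(N,2) ≤ 4N²` fails for `N ≥ 3`.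
* ⇒ `gottesmanCode_minDistance : minDistance (gottesmanCode G) = 3` (`m ≥ 3`, `G` fixed-point-free) and
  `gottesmanCode4_minDistance : minDistance (gottesmanCode4 G) = 4` (`m ≥ 4`, `G` injective) — the printed distances
  are EXACT — and the Q4 rows `gottesmanCode_hasOptimalRadius : AdditiveCode.HasOptimalRadius (gottesmanGen G) 1`,
  `gottesmanCode4_hasOptimalRadius : AdditiveCode.HasOptimalRadius (gottesmanGen4 G) 1` (radius `1` attained by
  minimum-weight syndrome decoding and unbeatable by ANY decoder), for every `m`.
* `fiveQubitCode_minDistance : minDistance fiveQubitCode = 3` (no `[[5,1,4]]` by quantum Singleton) and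
  `fiveQubitCode_hasOptimalRadius : AdditiveCode.HasOptimalRadius fiveQubitRows 1`.

Tier KERNEL: pure theorems (the all-`n` Hamming bound's small-`n` cells are kernel certificates upstream), no `decide`
on data, axioms standard. HONEST FRAMING: theorem-lane Q4 entries (generic min-weight decoder + optimality over all
decoders); no novelty — the distances are as printed; what is added is that «distance 3/4» is machine-checked to be exact.

References: [Gottesman1996] / [CalderbankEtAl1998, §5 Thm. 10 (printed pp. 15–16)] (the `[[2^m, 2^m−m−2, 3]]` class);
[Gottesman1997, §8.5 (chunk p0072 L1–24: `[2^j, 2^j − 2j − 2, 4]`), §2.3 (chunk p0014 L3: distance `2t+1` corrects `t`),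
§3.3 (chunk p0020 L55–57: the five-qubit code is perfect), Ch. 7 §7.3 (the quantum Hamming bound)].
-/

namespace Summit.Ventures.QEC.Decoders.GottesmanFamilies

open Matrix Literature.InformationTheory.QuantumCodes Summit.Ventures.QEC.Census.QuantumHammingBoundAllN

/-! ## An arithmetic helper (`m + 3 ≤ 2^m` is the tree's `Literature.InformationTheory.Coding.Vasilev.add_three_le_two_pow`) -/

/-- `2m + 3 ≤ 2^m` for `m ≥ 4`. [cite: Gottesman1997, §8.5 (chunk p0072: 2^j − 2j − 2 encoded qubits)] -/
theorem two_mul_add_three_le_two_pow {m : ℕ} (hm : 4 ≤ m) : 2 * m + 3 ≤ 2 ^ m := by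
  induction m, hm using Nat.le_induction with
  | base => norm_num
  | succ k _ ih => rw [pow_succ]; omega

/-! ## Pinning a distance by a nonexistence theorem -/

/-- **Exact distance from a nonexistence theorem**: if `S̄` is an `[[n,k,d]]` additive code with `k ≥ 1` and NO
`[[n,k,d+1]]` additive code exists, then `minDistance S̄ = d`. (proved)
[cite: CalderbankEtAl1998, §2 Thm. 1 (printed p. 4: the [[n,k,d]] predicate)] [cite: Gottesman1997, §3.2 (chunk p0018 L90–91: distance d iff N(S) − S has no element of weight < d)] -/
theorem minDistance_eq_of_not_additiveCodeExists {n k d : ℕ} {S : Submodule (ZMod 2) (SympVec n)}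
    (hS : IsAdditiveCode S k d) (hk : 1 ≤ k) (hno : ¬ AdditiveCodeExists n k (d + 1)) : minDistance S = d := by
  have hex : ∃ w ∈ sympDual S, w ∉ S :=
    (exists_logical_iff_logicalDim_pos hS.1).2 (by rw [hS.logicalDim_eq]; exact hk)
  have hle : d ≤ minDistance S := le_minDistance hex hS.2.2.1
  by_contra hne
  have hlt : d + 1 ≤ minDistance S := by omega
  exact hno ⟨S, hS.1, hS.2.1, hasMinDist_of_le_minDistance hlt, fun hk0 => absurd hk0 (by omega)⟩

/-! ## No `[[2^m, 2^m−m−2, 4]]` and no `[[2^m, 2^m−2m−2, 5]]` — the quantum Hamming bound at every length -/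

/-- **No `[[2^m, 2^m − m − 2, 4]]` additive code for `m ≥ 3`**: such a code would shorten (CRSS Thm 6 (d)) to an
`[[2^m − 1, 2^m − m − 2, 3]]` code, and the all-`n` quantum Hamming bound `(1 + 3n)·2^k ≤ 2^n` at `n = 2^m − 1` reads
`(3·2^m − 2)·2^{2^m−m−2} ≤ 2^{m+1}·2^{2^m−m−2}`, i.e. `3·2^m − 2 ≤ 2·2^m` — false. So Gottesman's distance-3 class has
distance EXACTLY 3. (proved) [cite: Gottesman1997, Ch. 7 §7.3 (chunk p0059 L57–60: the Hamming bound for impure distance-3 codes)] [cite: CalderbankEtAl1998, §4 Thm. 6 (d) (printed p. 13)] -/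
theorem not_additiveCodeExists_two_pow_four {m : ℕ} (hm : 3 ≤ m) :
    ¬ AdditiveCodeExists (2 ^ m) (2 ^ m - m - 2) 4 := by
  have hN : m + 3 ≤ 2 ^ m := Literature.InformationTheory.Coding.Vasilev.add_three_le_two_pow hm
  intro h
  set N := 2 ^ m with hNdef
  have h' : AdditiveCodeExists (N - 1 + 1) (N - m - 2) (3 + 1) := by
    rwa [show N - 1 + 1 = N by omega]
  have h3 : AdditiveCodeExists (N - 1) (N - m - 2) 3 :=
    CRSS1998_theorem6d (N - 1) (N - m - 2) 3 h' (by omega) (by omega)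
  have hq := quantumHammingBound_three_allN (N - 1) (N - m - 2) h3
  -- `2^(N-1) = 2^(m+1) * 2^(N-m-2)`
  have hsplit : 2 ^ (N - 1) = 2 ^ (m + 1) * 2 ^ (N - m - 2) := by
    rw [← pow_add]; congr 1; omega
  rw [hsplit] at hq
  have hq' : 1 + 3 * (N - 1) ≤ 2 ^ (m + 1) :=
    Nat.le_of_mul_le_mul_right hq (pow_pos (by norm_num) _)
  have h2N : 2 ^ (m + 1) = 2 * N := by rw [pow_succ, mul_comm]
  rw [h2N] at hq'
  omega

/-- **No `[[2^m, 2^m − 2m − 2, 5]]` additive code for `m ≥ 4`**: the all-`n` quantum Hamming bound for distance `5`,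
`(1 + 3N + 9·C(N,2))·2^{N−2m−2} ≤ 2^N = 4N²·2^{N−2m−2}`, would give `1 + 3N + 9·C(N,2) ≤ 4N²`, false for `N ≥ 3`. So
Gottesman's distance-4 class has distance EXACTLY 4. (proved)
[cite: Gottesman1997, Ch. 7 §7.3 (chunks p0059 L1–p0060 L30: the Hamming bound for t = 2)] -/
theorem not_additiveCodeExists_two_pow_five {m : ℕ} (hm : 4 ≤ m) :
    ¬ AdditiveCodeExists (2 ^ m) (2 ^ m - 2 * m - 2) 5 := by
  have hN : 2 * m + 3 ≤ 2 ^ m := two_mul_add_three_le_two_pow hm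
  intro h
  set N := 2 ^ m with hNdef
  have hq := quantumHammingBound_five_allN N (N - 2 * m - 2) h
  have hsplit : 2 ^ N = 2 ^ (2 * m + 2) * 2 ^ (N - 2 * m - 2) := by
    rw [← pow_add]; congr 1; omega
  rw [hsplit] at hq
  have hq' : 1 + 3 * N + 9 * N.choose 2 ≤ 2 ^ (2 * m + 2) :=
    Nat.le_of_mul_le_mul_right hq (pow_pos (by norm_num) _)
  have h4N : 2 ^ (2 * m + 2) = 4 * (N * N) := by
    rw [hNdef, two_mul, pow_add, pow_add]; ring
  rw [h4N] at hq'
  have hN3 : 3 ≤ N := by omega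
  -- `C(N,2)·2 = N(N−1)` and `N(N−1) + N = N·N`
  obtain ⟨n, hn⟩ : ∃ n, N = n + 1 := ⟨N - 1, by omega⟩
  have hc : N.choose 2 * 2 = N * (N - 1) := by
    have := Nat.add_one_mul_choose_eq n 1
    rw [Nat.choose_one_right] at this
    rw [hn, Nat.add_sub_cancel]
    exact this.symm
  have hNN : N * (N - 1) + N = N * N := by
    rw [← mul_add_one, Nat.sub_add_cancel (by omega : 1 ≤ N)]
  have h3N : 3 * N ≤ N * N := Nat.mul_le_mul_right N hN3
  omega

/-! ## Gottesman's `⟦2^m, 2^m − m − 2, 3⟧` class: exact distance and Q4 radius -/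

/-- **Exact distance `3`** of the CRSS Thm 10 / Gottesman 1996 code `G_m` (`m ≥ 3`, `G` a fixed-point-free
automorphism): `≥ 3` by `CRSS1998_theorem10`, `≤ 3` because no `[[2^m, 2^m−m−2, 4]]` code exists at all.
(proved) [cite: CalderbankEtAl1998, §5 Thm. 10 (printed pp. 15–16)] [cite: Gottesman1996, §3 (arXiv chunk p0008)] -/
theorem gottesmanCode_minDistance {m : ℕ} (hm : 3 ≤ m) (G : Matrix (Fin m) (Fin m) (ZMod 2))
    (hG : ∀ c, G *ᵥ c = 0 → c = 0) (hfix : ∀ c, G *ᵥ c = c → c = 0) :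
    minDistance (gottesmanCode G) = 3 := by
  have hN : m + 3 ≤ 2 ^ m := Literature.InformationTheory.Coding.Vasilev.add_three_le_two_pow hm
  exact minDistance_eq_of_not_additiveCodeExists (CRSS1998_theorem10 hm G hG hfix).1 (by omega)
    (not_additiveCodeExists_two_pow_four hm)

/-- **Q4 radius row of the `⟦2^m, 2^m − m − 2, 3⟧` class, every `m ≥ 3`**: optimal correction radius `1`, attained by
minimum-weight syndrome decoding of the generators `gottesmanGen G`, and no decoder corrects every Pauli error of
weight `≤ 2`. (proved) [cite: Gottesman1997, §2.3 (chunk p0014 L3: «to correct t errors … distance 2t+1»)] [cite: CalderbankEtAl1998, §5 Thm. 10 (printed pp. 15–16)] -/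
theorem gottesmanCode_hasOptimalRadius {m : ℕ} (hm : 3 ≤ m) (G : Matrix (Fin m) (Fin m) (ZMod 2))
    (hG : ∀ c, G *ᵥ c = 0 → c = 0) (hfix : ∀ c, G *ᵥ c = c → c = 0) :
    AdditiveCode.HasOptimalRadius (gottesmanGen G) 1 :=
  AdditiveCode.hasOptimalRadius_of_span_eq rfl (gottesmanCode_minDistance hm G hG hfix) (by norm_num) rfl

/-! ## Gottesman's `⟦2^m, 2^m − 2m − 2, 4⟧` class: exact distance and Q4 radius -/

/-- **Exact distance `4`** of Gottesman's distance-four code (`m ≥ 4`, `G` injective): `≥ 4` by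
`Gottesman1997_distance_four`, `≤ 4` because no `[[2^m, 2^m−2m−2, 5]]` code exists at all. (proved)
[cite: Gottesman1997, §8.5 (chunk p0072 L1–24: «[2^j, 2^j − 2j − 2, 4]»)] -/
theorem gottesmanCode4_minDistance {m : ℕ} (hm : 4 ≤ m) (G : Matrix (Fin m) (Fin m) (ZMod 2))
    (hG : ∀ c, G *ᵥ c = 0 → c = 0) : minDistance (gottesmanCode4 G) = 4 := by
  have hN : 2 * m + 3 ≤ 2 ^ m := two_mul_add_three_le_two_pow hm
  exact minDistance_eq_of_not_additiveCodeExists (Gottesman1997_distance_four hm G hG).1 (by omega)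
    (not_additiveCodeExists_two_pow_five hm)

/-- **Q4 radius row of the `⟦2^m, 2^m − 2m − 2, 4⟧` class, every `m ≥ 4`**: optimal correction radius `1 = ⌊(4−1)/2⌋`
(a distance-4 code corrects one error and detects two), attained by minimum-weight syndrome decoding of `gottesmanGen4 G`
and unbeatable. (proved) [cite: Gottesman1997, §8.5 (chunk p0072 L1–24) and §2.3 (chunk p0014 L3)] -/
theorem gottesmanCode4_hasOptimalRadius {m : ℕ} (hm : 4 ≤ m) (G : Matrix (Fin m) (Fin m) (ZMod 2))
    (hG : ∀ c, G *ᵥ c = 0 → c = 0) : AdditiveCode.HasOptimalRadius (gottesmanGen4 G) 1 :=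
  AdditiveCode.hasOptimalRadius_of_span_eq rfl (gottesmanCode4_minDistance hm G hG) (by norm_num) rfl

/-! ## The five-qubit code -/

/-- **Exact distance `3` of the five-qubit code**: `≥ 3` by `isAdditiveCode_fiveQubitCode`, `≤ 3` because no `[[5,1,4]]`
code exists (quantum Singleton `k + 2d ≤ n + 2`). (proved) [cite: Gottesman1997, §3.3 (chunk p0020 L55–57: the perfect five-qubit code)] [cite: Rains1999Nonbinary, Thm. 2 (quantum Singleton bound)] -/
theorem fiveQubitCode_minDistance : minDistance fiveQubitCode = 3 :=
  minDistance_eq_of_not_additiveCodeExists isAdditiveCode_fiveQubitCode.1 le_rfl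
    (not_additiveCodeExists_of_singleton (by norm_num) (by norm_num))

/-- **Q4 radius row of the five-qubit code**: optimal correction radius `1`, attained by minimum-weight syndrome decoding
of `fiveQubitRows` and unbeatable. (proved) [cite: Gottesman1997, §3.3 (chunk p0020 L55–57: «every possible error syndrome is used by the single-qubit errors»)] -/
theorem fiveQubitCode_hasOptimalRadius : AdditiveCode.HasOptimalRadius fiveQubitRows 1 :=
  AdditiveCode.hasOptimalRadius_of_span_eq rfl fiveQubitCode_minDistance (by norm_num) rfl

end Summit.Ventures.QEC.Decoders.GottesmanFamilies
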